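/-
Copyright (c) 2026 the pub-hodgecm-mathlib formalisation cell (harness21).  Prover seat hodgecm-mathlib-B-p14 (g32) — (R2) glue ∕ assembly heir, 2026-09-01.
«EP-UNR-ODD»: the (R2) relations and Kottwitz's Euler–Poincaré function on `U(Φ₂)(L⁺_v)` at every UNRAMIFIED non-split place `v ∤ 2`, HYPOTHESIS-FREE.
-/
import Literature.NumberTheory.Rogawski1990.RankOneEulerPoincareNonsplitUnramified          -- ★ (B-p14 g32) p843407: the assembly `…_of_typeTwo` (modulo the type-(2) count `hE₂`)
import Literature.NumberTheory.Automorphic.UnitaryTwoEulerPoincareEllipticTypeTwoDischarged  -- ★ (B-p08 g28) p843415: the type-(2) count from `hirr` alone, `natCard_fixedBy_add_eq_natCard_fixedBy_add_one_of_not_exists_isRoot'`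
import HarnessLib

/-!
# The Euler–Poincaré function on `U(Φ₂)(L⁺_v)` at an unramified non-split place of odd residue characteristic

Topic `NumberTheory/Rogawski1990`, namespace `Literature.NumberTheory.Rogawski1990`.  THEOREMS ONLY: no definition, no named fact, no instance, no notation,
no `sorry`; kernel lane.  The fold announced with ★ p843407: its one binder `hE₂` (Kottwitz's elliptic relation (E) for the regular elliptic `γ` of
TYPE (2), i.e. with `χ_{γ,w}` rootless in `L_w`) is discharged by ★ B-p08 (g28) `natCard_fixedBy_add_eq_natCard_fixedBy_add_one_of_not_exists_isRoot'`
(type-(2) Iwahori edge count + scalar-reduction dictionary + odd discriminant, [Kottwitz1988, §2]) under `2 ∈ 𝒪_w^×`; the only bridge is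
`χ_{γ_w} = χ_{γ,v}` read at `w` (`γ_w = e_w γ` is `γ_v` evaluated entrywise at `w`, ★ `coe_localNonsplitEquiv_apply`, and Mathlib `Matrix.charpoly_map`).
RESULTS, for `L` CM, `v` unramified and non-split in `L` with `2 ∈ 𝒪_w^×` (`w ∣ v`, `w̄ = w`), `ϖ` a `σ_w`-fixed uniformiser of `L_w`:
(§1) `epEllipticRelation_of_isUnit_two` — (E) at `K := U(Φ₂)(𝒪_v)`, `K′ := Ad_d K`, `I := K ⊓ K′` for EVERY regular elliptic `γ`;
(§2) `exists_epRelations_of_isUnit_two` — the per-place hypothesis `∃ K K′ I, open ∧ compact ×3 ∧ (E) ∧ (N)` of ★ `rankOneEulerPoincareNonsplit_of_relations`;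
(§3) `exists_isLocSmooth_classOrbitalIntegral_eq_one_zero_of_isUnit_two` — THE BODY OF THE LETTER ★ `RankOneEulerPoincareNonsplit` at `(L, v, ν, m)`:
`∃ f ∈ C_c^∞`, `Φ(⟦γ⟧, f) = 1` at regular elliptic classes, `= 0` at regular non-elliptic classes.  What remains for the letter (R2): the unramified
places over `2` (the type-blind tree relation ★ A-p17 `natCard_fixedBy_add_eq_natCard_fixedBy_add_one_congr` through ★ `exists_epRelations_of_ellipticRelation`)
and the ramified non-split places (A-p06 (g27)'s (R2-ram) road).
HONEST LABEL: HC_CM is proved only modulo the cell's remaining named inputs (hLiu418, h413) until rung 0 closes; this file is unconditional.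

## References
* [Kottwitz1988] R. E. Kottwitz, *Tamagawa numbers*, Ann. of Math. 127 (1988), 629–646, §2 Theorem 2.
* [Rogawski1990] J. D. Rogawski, *Automorphic Representations of Unitary Groups in Three Variables* (1990), §12.6–12.7 pp. 174–176.
* [Serre1980Trees] J.-P. Serre, *Trees* (1980), Ch. II §1.1.
-/

set_option autoImplicit false

noncomputable section

open scoped ValuativeRel Matrix MatrixGroups
open Matrix ValuativeRel NumberField IsDedekindDomain MulAction MeasureTheory Measure

namespace Literature.NumberTheory.Rogawski1990

open Literature.NumberTheory.Automorphic Literature.NumberTheory.Automorphic.UnitaryGroup Literature.NumberTheory.GaloisRepresentations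

section Odd

variable (L : Type) [Field L] [NumberField L] [IsCMField L] {v : HeightOneSpectrum (𝓞 ↥(maximalRealSubfield L))}
  (w : PlacesOver L v) (hw : IsCMField.complexConj L • w.1 = w.1)
  (ϖ : (w.1.adicCompletion L)ˣ) (hϖ : Valued.v (ϖ : w.1.adicCompletion L) = WithZero.exp (-1 : ℤ))
  (hσϖ : galAdicCompletionMap (L := L) (IsCMField.complexConj L) hw (ϖ : w.1.adicCompletion L) = ϖ)

/-! ## §1 (E) at `K, K′, I` for every regular elliptic class, `v ∤ 2` unramified -/

include hw hϖ hσϖ in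
/-- **KOTTWITZ'S ELLIPTIC RELATION (E) AT `K, K′ := Ad_d K, I := K ⊓ K′`, for EVERY regular elliptic `γ ∈ U(Φ₂)(L⁺_v)`**, `v` unramified non-split with
`2 ∈ 𝒪_w^×`: `#Fix(U₂⧸K, γ) + #Fix(U₂⧸K′, γ) = #Fix(U₂⧸I, γ) + 1` — ★ `epEllipticRelation_of_typeTwo` (type (1) ★ p843377) with its type-(2) binder discharged by
★ B-p08 `natCard_fixedBy_add_eq_natCard_fixedBy_add_one_of_not_exists_isRoot'`. [cite: Kottwitz1988, §2 Theorem 2] [cite: Rogawski1990, §12.6 p. 174; §12.7 Lemma 12.7.1 p. 176] -/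
theorem epEllipticRelation_of_isUnit_two (hunr : Algebra.IsUnramifiedIn (𝓞 L) v.asIdeal) (h2 : IsUnit (2 : 𝒪[w.1.adicCompletion L]))
    (γ : (cmDatum L 2 (Matrix.of fun i j : Fin 2 => if i.val + j.val + 1 = 2 then (1 : L) else 0)).Local v)
    (hreg : IsRegularElt (γ.val : GL (Fin 2) (UnitaryGroup.LocalRing L v)))
    (hc : CompactSpace (Subgroup.centralizer ({γ} : Set ((cmDatum L 2 (Matrix.of fun i j : Fin 2 => if i.val + j.val + 1 = 2 then (1 : L) else 0)).Local v)))) :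
    Nat.card (fixedBy ((cmDatum L 2 (Matrix.of fun i j : Fin 2 => if i.val + j.val + 1 = 2 then (1 : L) else 0)).Local v ⧸
          cmLocalIntegralLevel L 2 (Matrix.of fun i j : Fin 2 => if i.val + j.val + 1 = 2 then (1 : L) else 0) v) γ) +
        Nat.card (fixedBy ((cmDatum L 2 (Matrix.of fun i j : Fin 2 => if i.val + j.val + 1 = 2 then (1 : L) else 0)).Local v ⧸
          (cmLocalIntegralLevel L 2 (Matrix.of fun i j : Fin 2 => if i.val + j.val + 1 = 2 then (1 : L) else 0) v).map
            (cmDatumLocalNonsplitCongr L w hw (glDiagonal 2 (w.1.adicCompletion L) ![1, ϖ]) ϖ.isUnit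
              (formCongr_glDiagonal_eq_smul_two L w hw ϖ hσϖ)).toMulEquiv.toMonoidHom) γ) =
      Nat.card (fixedBy ((cmDatum L 2 (Matrix.of fun i j : Fin 2 => if i.val + j.val + 1 = 2 then (1 : L) else 0)).Local v ⧸
          (cmLocalIntegralLevel L 2 (Matrix.of fun i j : Fin 2 => if i.val + j.val + 1 = 2 then (1 : L) else 0) v ⊓
            (cmLocalIntegralLevel L 2 (Matrix.of fun i j : Fin 2 => if i.val + j.val + 1 = 2 then (1 : L) else 0) v).map
              (cmDatumLocalNonsplitCongr L w hw (glDiagonal 2 (w.1.adicCompletion L) ![1, ϖ]) ϖ.isUnit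
                (formCongr_glDiagonal_eq_smul_two L w hw ϖ hσϖ)).toMulEquiv.toMonoidHom)) γ) + 1 := by
  refine epEllipticRelation_of_typeTwo L w hw ϖ hϖ hσϖ hunr (fun δ _ _ hroot => ?_) γ hreg hc
  refine natCard_fixedBy_add_eq_natCard_fixedBy_add_one_of_not_exists_isRoot' L v w hw hunr h2 ϖ hσϖ _ _ _
    (fun g => mem_localIntegralLevel_iff_of_smul_eq (IsCMField.complexConj L) 2 _ (IsCMField.complexConj_ne_one L) w hw g)
    (mem_map_cmDatumLocalNonsplitCongr_cmLocalIntegralLevel_iff L w hw ϖ hσϖ)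
    (mem_cmLocalIntegralLevel_inf_map_iff L w hw ϖ hϖ hσϖ) δ ?_
  -- `γ_w = e_w δ` is `δ_v` evaluated entrywise at `w` (definitional), so `χ_{γ_w} = χ_{δ_v}` read at `w`
  have hcoe : (((localNonsplitEquiv (IsCMField.complexConj L) (Matrix.of fun i j : Fin 2 => if i.val + j.val + 1 = 2 then (1 : L) else 0)
      (IsCMField.complexConj_ne_one L) w hw δ :
      unitaryGroupOfForm (galAdicCompletionMap (L := L) (IsCMField.complexConj L) hw)
        (placeForm (Matrix.of fun i j : Fin 2 => if i.val + j.val + 1 = 2 then (1 : L) else 0) w.1)) :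
      GL (Fin 2) (w.1.adicCompletion L)) : Matrix (Fin 2) (Fin 2) (w.1.adicCompletion L)) =
      ((δ.val : GL (Fin 2) (UnitaryGroup.LocalRing L v)) : Matrix (Fin 2) (Fin 2) (UnitaryGroup.LocalRing L v)).map
        (Pi.evalRingHom (fun w' : PlacesOver L v => w'.1.adicCompletion L) w) := rfl
  rw [hcoe, Matrix.charpoly_map]
  exact hroot

/-! ## §2 The relations package at `v ∤ 2` unramified non-split -/

variable
  [MeasurableSpace ((cmDatum L 2 (Matrix.of fun i j : Fin 2 => if i.val + j.val + 1 = 2 then (1 : L) else 0)).Local v)]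
  [BorelSpace ((cmDatum L 2 (Matrix.of fun i j : Fin 2 => if i.val + j.val + 1 = 2 then (1 : L) else 0)).Local v)]
  [∀ γ : (cmDatum L 2 (Matrix.of fun i j : Fin 2 => if i.val + j.val + 1 = 2 then (1 : L) else 0)).Local v,
    MeasurableSpace (((cmDatum L 2 (Matrix.of fun i j : Fin 2 => if i.val + j.val + 1 = 2 then (1 : L) else 0)).Local v) ⧸
      Subgroup.centralizer ({γ} : Set ((cmDatum L 2 (Matrix.of fun i j : Fin 2 => if i.val + j.val + 1 = 2 then (1 : L) else 0)).Local v)))]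
  [∀ γ : (cmDatum L 2 (Matrix.of fun i j : Fin 2 => if i.val + j.val + 1 = 2 then (1 : L) else 0)).Local v,
    BorelSpace (((cmDatum L 2 (Matrix.of fun i j : Fin 2 => if i.val + j.val + 1 = 2 then (1 : L) else 0)).Local v) ⧸
      Subgroup.centralizer ({γ} : Set ((cmDatum L 2 (Matrix.of fun i j : Fin 2 => if i.val + j.val + 1 = 2 then (1 : L) else 0)).Local v)))]
  (ν : Measure ((cmDatum L 2 (Matrix.of fun i j : Fin 2 => if i.val + j.val + 1 = 2 then (1 : L) else 0)).Local v))
  [IsHaarMeasure ν] [ν.IsMulRightInvariant]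

include hw hϖ hσϖ in
/-- **THE (R2) RELATIONS PACKAGE AT AN UNRAMIFIED NON-SPLIT PLACE OF ODD RESIDUE CHARACTERISTIC, HYPOTHESIS-FREE** — the per-place hypothesis of ★
`rankOneEulerPoincareNonsplit_of_relations` at `(L, v)`: `∃ K K′ I ≤ U(Φ₂)(L⁺_v)` compact open with (E) at every regular elliptic class and (N) at every
regular non-elliptic class (`K = U(Φ₂)(𝒪_v)`, `K′ = Ad_d K`, `I = K ⊓ K′`). [cite: Kottwitz1988, §2 Theorem 2] [cite: Rogawski1990, §12.6 p. 174] [cite: Serre1980Trees, II.1.1] -/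
theorem exists_epRelations_of_isUnit_two (hunr : Algebra.IsUnramifiedIn (𝓞 L) v.asIdeal) (h2 : IsUnit (2 : 𝒪[w.1.adicCompletion L]))
    {m : OrbitalMeasureFamily ((cmDatum L 2 (Matrix.of fun i j : Fin 2 => if i.val + j.val + 1 = 2 then (1 : L) else 0)).Local v)}
    (hm : m.IsCanonical (fun γ => IsRegularElt (γ.val : GL (Fin 2) (UnitaryGroup.LocalRing L v))) ν) :
    ∃ K K' I : Subgroup ((cmDatum L 2 (Matrix.of fun i j : Fin 2 => if i.val + j.val + 1 = 2 then (1 : L) else 0)).Local v),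
      IsOpen (K : Set ((cmDatum L 2 (Matrix.of fun i j : Fin 2 => if i.val + j.val + 1 = 2 then (1 : L) else 0)).Local v)) ∧
      IsCompact (K : Set ((cmDatum L 2 (Matrix.of fun i j : Fin 2 => if i.val + j.val + 1 = 2 then (1 : L) else 0)).Local v)) ∧
      IsOpen (K' : Set ((cmDatum L 2 (Matrix.of fun i j : Fin 2 => if i.val + j.val + 1 = 2 then (1 : L) else 0)).Local v)) ∧
      IsCompact (K' : Set ((cmDatum L 2 (Matrix.of fun i j : Fin 2 => if i.val + j.val + 1 = 2 then (1 : L) else 0)).Local v)) ∧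
      IsOpen (I : Set ((cmDatum L 2 (Matrix.of fun i j : Fin 2 => if i.val + j.val + 1 = 2 then (1 : L) else 0)).Local v)) ∧
      IsCompact (I : Set ((cmDatum L 2 (Matrix.of fun i j : Fin 2 => if i.val + j.val + 1 = 2 then (1 : L) else 0)).Local v)) ∧
      (∀ γ : (cmDatum L 2 (Matrix.of fun i j : Fin 2 => if i.val + j.val + 1 = 2 then (1 : L) else 0)).Local v,
        IsRegularElt (γ.val : GL (Fin 2) (UnitaryGroup.LocalRing L v)) →
        CompactSpace (Subgroup.centralizer
          ({γ} : Set ((cmDatum L 2 (Matrix.of fun i j : Fin 2 => if i.val + j.val + 1 = 2 then (1 : L) else 0)).Local v))) →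
        Nat.card (fixedBy ((cmDatum L 2 (Matrix.of fun i j : Fin 2 => if i.val + j.val + 1 = 2 then (1 : L) else 0)).Local v ⧸ K) γ) +
          Nat.card (fixedBy ((cmDatum L 2 (Matrix.of fun i j : Fin 2 => if i.val + j.val + 1 = 2 then (1 : L) else 0)).Local v ⧸ K') γ) =
          Nat.card (fixedBy ((cmDatum L 2 (Matrix.of fun i j : Fin 2 => if i.val + j.val + 1 = 2 then (1 : L) else 0)).Local v ⧸ I) γ) + 1) ∧
      (∀ γ : (cmDatum L 2 (Matrix.of fun i j : Fin 2 => if i.val + j.val + 1 = 2 then (1 : L) else 0)).Local v,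
        IsRegularElt (γ.val : GL (Fin 2) (UnitaryGroup.LocalRing L v)) →
        ¬ CompactSpace (Subgroup.centralizer
          ({γ} : Set ((cmDatum L 2 (Matrix.of fun i j : Fin 2 => if i.val + j.val + 1 = 2 then (1 : L) else 0)).Local v))) →
        (((ν K).toReal : ℂ))⁻¹ * classOrbitalIntegral m
            ((K : Set ((cmDatum L 2 (Matrix.of fun i j : Fin 2 => if i.val + j.val + 1 = 2 then (1 : L) else 0)).Local v)).indicator fun _ => (1 : ℂ))
            (ConjClasses.mk γ) +
          (((ν K').toReal : ℂ))⁻¹ * classOrbitalIntegral m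
            ((K' : Set ((cmDatum L 2 (Matrix.of fun i j : Fin 2 => if i.val + j.val + 1 = 2 then (1 : L) else 0)).Local v)).indicator fun _ => (1 : ℂ))
            (ConjClasses.mk γ) -
          (((ν I).toReal : ℂ))⁻¹ * classOrbitalIntegral m
            ((I : Set ((cmDatum L 2 (Matrix.of fun i j : Fin 2 => if i.val + j.val + 1 = 2 then (1 : L) else 0)).Local v)).indicator fun _ => (1 : ℂ))
            (ConjClasses.mk γ) = 0) :=
  exists_epRelations_of_ellipticRelation L w hw ϖ hϖ hσϖ ν hm (epEllipticRelation_of_isUnit_two L w hw ϖ hϖ hσϖ hunr h2)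

/-! ## §3 Kottwitz's Euler–Poincaré function at `v ∤ 2` unramified non-split -/

include hw hϖ hσϖ in
/-- **KOTTWITZ'S EULER–POINCARÉ FUNCTION ON `U(Φ₂)(L⁺_v)` AT AN UNRAMIFIED NON-SPLIT PLACE OF ODD RESIDUE CHARACTERISTIC, HYPOTHESIS-FREE**: for every
two-sided Haar `ν` and every canonical orbital-measure family `m` there is a locally constant compactly supported `f` with `Φ(⟦γ⟧, f) = 1` at every regular
elliptic class and `= 0` at every regular non-elliptic class — THE BODY OF THE LETTER ★ `RankOneEulerPoincareNonsplit` at `(L, v, ν, m)`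
(the `σ_w`-fixed uniformiser `ϖ` only parametrises the proof). [cite: Kottwitz1988, §2 Theorem 2] [cite: Rogawski1990, §12.6 p. 174; §12.7 Lemma 12.7.1 p. 176] -/
theorem exists_isLocSmooth_classOrbitalIntegral_eq_one_zero_of_isUnit_two (hunr : Algebra.IsUnramifiedIn (𝓞 L) v.asIdeal)
    (h2 : IsUnit (2 : 𝒪[w.1.adicCompletion L]))
    {m : OrbitalMeasureFamily ((cmDatum L 2 (Matrix.of fun i j : Fin 2 => if i.val + j.val + 1 = 2 then (1 : L) else 0)).Local v)}
    (hm : m.IsCanonical (fun γ => IsRegularElt (γ.val : GL (Fin 2) (UnitaryGroup.LocalRing L v))) ν) :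
    ∃ f : (cmDatum L 2 (Matrix.of fun i j : Fin 2 => if i.val + j.val + 1 = 2 then (1 : L) else 0)).Local v → ℂ, IsLocSmooth f ∧
      (∀ γ : (cmDatum L 2 (Matrix.of fun i j : Fin 2 => if i.val + j.val + 1 = 2 then (1 : L) else 0)).Local v,
          IsRegularElt (γ.val : GL (Fin 2) (UnitaryGroup.LocalRing L v)) →
          CompactSpace (Subgroup.centralizer ({γ} : Set ((cmDatum L 2 (Matrix.of fun i j : Fin 2 => if i.val + j.val + 1 = 2 then (1 : L) else 0)).Local v))) →
          classOrbitalIntegral m f (ConjClasses.mk γ) = 1) ∧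
      (∀ γ : (cmDatum L 2 (Matrix.of fun i j : Fin 2 => if i.val + j.val + 1 = 2 then (1 : L) else 0)).Local v,
          IsRegularElt (γ.val : GL (Fin 2) (UnitaryGroup.LocalRing L v)) →
          ¬ CompactSpace (Subgroup.centralizer ({γ} : Set ((cmDatum L 2 (Matrix.of fun i j : Fin 2 => if i.val + j.val + 1 = 2 then (1 : L) else 0)).Local v))) →
          classOrbitalIntegral m f (ConjClasses.mk γ) = 0) :=
  exists_isLocSmooth_classOrbitalIntegral_eq_one_zero_of_ellipticRelation L w hw ϖ hϖ hσϖ ν hm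
    (epEllipticRelation_of_isUnit_two L w hw ϖ hϖ hσϖ hunr h2)

end Odd

end Literature.NumberTheory.Rogawski1990

end
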